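import Summits.QuantumFields.YangMills.Theorems.AllWindowsColdBoxBoxHighLineOrbitJacobianDefs
import Summits.QuantumFields.YangMills.Theorems.AllWindowsColdBoxBoxHighLineJacWeight

/-!
# T-S5 STEP 2 — T-S5.5J `FPRepresentation`: the Faddeev–Popov representation of gauge-invariant box expectations (task statement;
planner ym-idea-2 g18)

The bridge from STEP 1 (✓T-S5.4J `orbitNormaliserJacobianR : OrbitNormaliserJacobianR`, file `…OrbitJacobianClosed.lean`) to the chart
expansion of STEP 2 (`STUB-PLAN-S5-STEP2.md` §2 (c)).  For a gauge-invariant observable `0 ≤ F ≤ 1` of the cold box,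

  `| E_box[F] − E_box[F · h_J · 1_SP] / E_box[h_J · 1_SP] | ≤ 4δ + 4·P_box(¬SP)`,

where `h_J = jacWeight β H r` (`= e^{−βΦ} χ_r |det F_FP|`), `SP = SmallPlaquettes H spl` (gauge invariant), PROVIDED (i) every cold-wall
small-plaquette configuration has an interior-gauge Landau representative with box links of defect `≤ r₀²` (the conclusion of ✓S4b
`LandauBootstrapBound` at `(H, spl, r₀)`) and (ii) the orbit normaliser of every such representative is `Z₀(1 ± δ)` (the conclusion of ✓T-S5.4J at
`(H, β, r₀, r)`).

WHY NO RARITY-VERSUS-`Z₀` COMPARISON IS NEEDED (design note): the smeared FP identity ✓`integral_mul_jacWeight_floor_div_orbitAverage_eq`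
(`E[F] = E[F·(h_J+ε)/N_ε]`, `N_ε = orbitAverage (h_J + ε)`, every `ε > 0`) is applied to the invariant observables `F·1_SP` and `1_SP` only; ON `SP`
the normaliser is `Z₀(1±δ) + ε` by (i)+(ii) and gauge invariance of `orbitAverage`, so letting `ε → 0`,
`Z₀(1−δ)·E[F 1_SP] ≤ E[F h_J 1_SP] ≤ Z₀(1+δ)·E[F 1_SP]`; orbits OFF `SP` (whose normaliser may be astronomically larger than `Z₀`) enter only through
`E[F·1_{¬SP}] ≤ P(¬SP)`, additively.  With `δ ≤ 1/2`: `|E[F1_SP]/P(SP) − E[F]| ≤ 2P(¬SP)` and the ratio of the two sandwiches is within `1 ± 4δ`.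
Size S/M (measure plumbing + `ε → 0` by dominated convergence, or directly with `ε = Z₀·δ`).

Downstream (T-S5.13, the S5 assembly): `spl = β^{ε₁ − 1/2}` with `κ₃ < ε₁ < 1/2 − 4θ` (so `smallField s ⊆ SP` in the chart and ✓S4b applies),
`r₀² = C_{4b} H²(1+log H)⁴ spl²`, `r = r₀ + 1/(H⁴(1+log β)²)`, `δ = e^{−cH⁴}`, `P(¬SP) ≤ exp(−β^{ε₁})`-type rarity (✓`exists_boxState_largeField_le`);
then ✓T-S5.14 `BoxStateEdgeChart` turns `E_box[G·h_J·1_SP]` into the chart integral of `G ∘ edgeChart` against `fpChartWeight β H r · (1_SP ∘ edgeChart)`.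

HONEST LABEL: a task statement; S5, ⟨stmt-QuantumFields-24004⟩ ⟨24335⟩ ⟨24336⟩ remain OPEN; route AllWindowsColdBox is DRAFT; no rung is
proved; the Yang–Mills mass gap is NOT proved by this file; no summit is proved by a line.
-/

set_option autoImplicit false

noncomputable section

open MeasureTheory
open Literature.Probability.LatticeModels (Site)
open Literature.MathematicalPhysics.QuantumFieldTheory.AxialGauge (boxEdges)
open Literature.MathematicalPhysics.QuantumLattice (LGConfig gaugeTransformZd fundamentalRep)
open Summit.QuantumFields.YangMills.Theorems.WeakCouplingRates (boxState)

namespace Summit.QuantumFields.YangMills.Theorems.AllWindowsColdBoxBoxHighLine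

open Classical in
/-- Indicator of the (gauge-invariant, closed) small-plaquette event `SmallPlaquettes H spl`. -/
def spIndicator (H : ℕ) (spl : ℝ) (U : LGConfig 4 SU2) : ℝ := if SmallPlaquettes H spl U then 1 else 0

/-- **T-S5.5J `FPRepresentation`** (S/M) — see the module docstring. -/
def FPRepresentation : Prop :=
  ∀ (H : ℕ) (β r r₀ spl δ : ℝ), 1 ≤ H → 0 < β → 0 ≤ δ → δ ≤ 1 / 2 →
    (∀ U : LGConfig 4 SU2, ColdWall H U → SmallPlaquettes H spl U →
        ∃ g : Site 4 → SU2, IsInteriorGauge H g ∧ InLandauGauge H (gaugeTransformZd g U) ∧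
          ∀ e ∈ boxEdges 4 (2 * H + 1), linkDefect (gaugeTransformZd g U) e ≤ r₀ ^ 2) →
    (∀ V : LGConfig 4 SU2, InLandauGauge H V → (∀ e ∈ boxEdges 4 (2 * H + 1), linkDefect V e ≤ r₀ ^ 2) →
        |orbitAverage H (jacWeight β H r) V / laplaceZ0 β H - 1| ≤ δ) →
    ∀ F : LGConfig 4 SU2 → ℝ, (∀ g : InteriorGauge H, ∀ U, F (gaugeTransformZd (extendGauge H g) U) = F U) →
      Measurable F → (∀ U, 0 ≤ F U) → (∀ U, F U ≤ 1) →
      |(∫ U, F U ∂(boxState (fundamentalRep (Fin 2)) β H)) -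
          (∫ U, F U * (jacWeight β H r U * spIndicator H spl U) ∂(boxState (fundamentalRep (Fin 2)) β H)) /
            (∫ U, jacWeight β H r U * spIndicator H spl U ∂(boxState (fundamentalRep (Fin 2)) β H))| ≤
        4 * δ + 4 * ((boxState (fundamentalRep (Fin 2)) β H) {U | ¬ SmallPlaquettes H spl U}).toReal

example : FPRepresentation → True := fun _ => trivial

end Summit.QuantumFields.YangMills.Theorems.AllWindowsColdBoxBoxHighLine

end
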